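import Mathlib
import Summits.MatrixMultiplication.MatrixMultiplication.Theorems.SnSubsetDichotomyPolynomialSlackBlockCounts
import Summits.MatrixMultiplication.MatrixMultiplication.Theorems.SnSubsetDichotomyPolynomialSlackHubFibring
import Summits.MatrixMultiplication.MatrixMultiplication.Theorems.SnSubsetDichotomyPolynomialSlackHubSelect
import Summits.MatrixMultiplication.MatrixMultiplication.Theorems.SnSubsetDichotomyPolynomialSlackGoodValue
import Summits.MatrixMultiplication.MatrixMultiplication.Theorems.SnSubsetDichotomyPolynomialSlackMarginals
import Summits.MatrixMultiplication.MatrixMultiplication.Theorems.SnSubsetDichotomyPolynomialSlackSpreadLevelOne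

/-!
# The hub: from the kept level-one term to one-point fibring

Crux `Summit.MatrixMultiplication.MatrixMultiplication.Theses.SnSubsetDichotomy.PolynomialSlack`
(item `stmt-MatrixMultiplication-8306`), level-one programme, lead c6 ("beyond one half"), the case of one
dense quotient set. For a TPP triple `S, T, U ⊆ S_n` with quotient profiles `d_A = m_{ST}/|S||T|`,
`d_B = m_{TU}/|T||U|`, `d_C = m_{US}/|U||S|`, heavy thresholds `θ_B, θ_C ≥ 16/n` and heavy parts
`p_X = (d_X - 1/n)·[d_X ≥ θ_X]`, the kept level-one inequality `1 - δ ≤ -(n-1)Σ (d_A - 1/n) p_B p_C`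
(file `…KeptTerm`) together with the heavy-mass bounds `Σ_heavy d_B, Σ_heavy d_C ≤ Λ` (one of them
`≤ 1 + δ₄`) forces `|S||T||U| ≤ 100·Λ³·B/((n-1)θ_B²θ_C²)` for every bound `B` on TPP volumes of `S_{n-1}`
(`volume_le_of_hub`): the kept term is `((n-1)/n)Σ_k σ_kρ_k - (n-1)Σ_k Ψ_k` (column/row heavy masses
`σ_k, ρ_k`, nonnegative `Ψ_k`); `exists_hub_of_masses` picks a hub `k`; the forced-hits identity
`Σ_{I_k×J_k} d_A = Σ_v X(v)Y(v)` (`sum_pairMarginal_block_eq`) and `Ψ_k ≥ (15/16)²θ_Bθ_C Σ_{I_k×J_k} d_A`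
feed `exists_good_value`, and `hub_fibring` bounds the resulting sub-triple at the good value.
-/


namespace Summit.MatrixMultiplication.MatrixMultiplication.Theorems.PolynomialSlack

open scoped BigOperators
open Literature.Combinatorics.Additive (TripleProductProperty)

-- `Summit.<Summit>.<Problem>` is the tree's mandated summit-side namespace (CONVENTIONS §2); for
-- this single-conjunct summit the two coincide, so each declaration silences `dupNamespace`.
set_option linter.dupNamespace false

set_option maxHeartbeats 1600000 in
/-- **The hub bound.** For `n ≥ 2`, a TPP triple `S, T, U ⊆ S_n` of non-empty sets, a bound `B` on the
volumes of TPP triples of `S_{n-1}`, quotient profiles `dA, dB, dC`, heavy thresholds `θB, θC ≥ 16/n`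
with heavy parts `pB, pC`, heavy masses `≤ Λ` (one of them `≤ 1 + δ₄`), `δ + δ₄ ≤ 1/(64Λ²)`, and the
kept level-one inequality `1 - δ ≤ -(n-1)·Σ (dA - 1/n)·pB·pC`:
`|S||T||U| ≤ 100·Λ³·B/((n-1)·θB²·θC²)`. [folklore] -/
theorem volume_le_of_hub {n : ℕ} (hn : 2 ≤ n) (B : ℕ)
    (hB : ∀ S' T' U' : Finset (Equiv.Perm (Fin (n - 1))), TripleProductProperty S' T' U' →
      S'.card * T'.card * U'.card ≤ B)
    {S T U : Finset (Equiv.Perm (Fin n))} (hTPP : TripleProductProperty S T U)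
    (hS0 : S.Nonempty) (hT0 : T.Nonempty) (hU0 : U.Nonempty)
    (dA dB dC pB pC : Fin n → Fin n → ℝ)
    (hdA : ∀ i j, dA i j = (((S ×ˢ T).filter fun st => st.2 j = st.1 i).card : ℝ) / (S.card * T.card : ℕ))
    (hdB : ∀ j k, dB j k = (((T ×ˢ U).filter fun tu => tu.2 k = tu.1 j).card : ℝ) / (T.card * U.card : ℕ))
    (hdC : ∀ k i, dC k i = (((U ×ˢ S).filter fun us => us.2 i = us.1 k).card : ℝ) / (U.card * S.card : ℕ))
    (θB θC Λ δ δ₄ : ℝ) (hθB : 16 / (n : ℝ) ≤ θB) (hθC : 16 / (n : ℝ) ≤ θC)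
    (hpB : ∀ j k, pB j k = if θB ≤ dB j k then dB j k - 1 / n else 0)
    (hpC : ∀ k i, pC k i = if θC ≤ dC k i then dC k i - 1 / n else 0)
    (hΛ : 1 ≤ Λ) (hδ : 0 ≤ δ) (hδ₄ : 0 ≤ δ₄) (hsmall : δ + δ₄ ≤ 1 / (64 * Λ ^ 2))
    (hmassB : ∑ j : Fin n, ∑ k : Fin n, (if θB ≤ dB j k then dB j k else 0) ≤ Λ)
    (hmassC : ∑ k : Fin n, ∑ i : Fin n, (if θC ≤ dC k i then dC k i else 0) ≤ Λ)
    (hsharp : ∑ j : Fin n, ∑ k : Fin n, (if θB ≤ dB j k then dB j k else 0) ≤ 1 + δ₄ ∨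
      ∑ k : Fin n, ∑ i : Fin n, (if θC ≤ dC k i then dC k i else 0) ≤ 1 + δ₄)
    (hkept : 1 - δ ≤ -((n : ℝ) - 1) *
      ∑ i : Fin n, ∑ j : Fin n, ∑ k : Fin n, (dA i j - 1 / n) * pB j k * pC k i) :
    ((S.card * T.card * U.card : ℕ) : ℝ) ≤ 100 * Λ ^ 3 * B / (((n : ℝ) - 1) * θB ^ 2 * θC ^ 2) := by
  classical
  /- 0. scalars -/
  have hn1 : 1 ≤ n := by omega
  have hnR : (2 : ℝ) ≤ n := by exact_mod_cast hn
  have hn0 : (0 : ℝ) < n := by linarith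
  have hm0 : (0 : ℝ) < (n : ℝ) - 1 := by linarith
  have h16n : (0 : ℝ) < 16 / n := by positivity
  have hθB0 : 0 < θB := lt_of_lt_of_le h16n hθB
  have hθC0 : 0 < θC := lt_of_lt_of_le h16n hθC
  have hΛ0 : 0 < Λ := by linarith
  have h16 : (0 : ℝ) < 16 := by norm_num
  have hinvB : 1 / (n : ℝ) ≤ θB / 16 := by
    rw [div_le_div_iff₀ hn0 h16]; rw [div_le_iff₀ hn0] at hθB; linarith
  have hinvC : 1 / (n : ℝ) ≤ θC / 16 := by
    rw [div_le_div_iff₀ hn0 h16]; rw [div_le_iff₀ hn0] at hθC; linarith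
  set cS : ℝ := (S.card : ℝ) with hcS
  set cT : ℝ := (T.card : ℝ) with hcT
  set cU : ℝ := (U.card : ℝ) with hcU
  have hcS0 : 0 < cS := by rw [hcS]; exact_mod_cast hS0.card_pos
  have hcT0 : 0 < cT := by rw [hcT]; exact_mod_cast hT0.card_pos
  have hcU0 : 0 < cU := by rw [hcU]; exact_mod_cast hU0.card_pos
  have hαe : ((S.card * T.card : ℕ) : ℝ) = cS * cT := by push_cast; rw [hcS, hcT]
  have hβe : ((T.card * U.card : ℕ) : ℝ) = cT * cU := by push_cast; rw [hcT, hcU]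
  have hγe : ((U.card * S.card : ℕ) : ℝ) = cU * cS := by push_cast; rw [hcU, hcS]
  have hNe : ((S.card * T.card * U.card : ℕ) : ℝ) = cS * cT * cU := by push_cast; rw [hcS, hcT, hcU]
  have hTfil : ∀ (p : Equiv.Perm (Fin n) → Prop) [DecidablePred p], ((T.filter p).card : ℝ) ≤ cT :=
    fun p _ => by rw [hcT]; exact_mod_cast Finset.card_filter_le _ _
  have hSfil : ∀ (p : Equiv.Perm (Fin n) → Prop) [DecidablePred p], ((S.filter p).card : ℝ) ≤ cS :=
    fun p _ => by rw [hcS]; exact_mod_cast Finset.card_filter_le _ _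
  have hUcol : ∀ k : Fin n, ∑ v : Fin n, ((U.filter fun u => u k = v).card : ℝ) = cU := fun k => by
    rw [hcU]; exact sum_marginal_col U k
  have hcUne : cU ≠ 0 := hcU0.ne'
  clear_value cS cT cU
  /- 1. the marginals and the profiles -/
  set mA : Fin n → Fin n → ℝ := fun i j => (((S ×ˢ T).filter fun st => st.2 j = st.1 i).card : ℝ) with hmA
  set mB : Fin n → Fin n → ℝ := fun j k => (((T ×ˢ U).filter fun tu => tu.2 k = tu.1 j).card : ℝ) with hmB
  set mC : Fin n → Fin n → ℝ := fun k i => (((U ×ˢ S).filter fun us => us.2 i = us.1 k).card : ℝ) with hmC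
  have hdA' : ∀ i j, dA i j = mA i j / (cS * cT) := fun i j => by rw [hdA, hαe]
  have hdB' : ∀ j k, dB j k = mB j k / (cT * cU) := fun j k => by rw [hdB, hβe]
  have hdC' : ∀ k i, dC k i = mC k i / (cU * cS) := fun k i => by rw [hdC, hγe]
  have hmA0 : ∀ i j, 0 ≤ mA i j := fun i j => by simp only [hmA]; exact Nat.cast_nonneg _
  have hmB0 : ∀ j k, 0 ≤ mB j k := fun j k => by simp only [hmB]; exact Nat.cast_nonneg _
  have hmC0 : ∀ k i, 0 ≤ mC k i := fun k i => by simp only [hmC]; exact Nat.cast_nonneg _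
  have hdA0 : ∀ i j, 0 ≤ dA i j := fun i j => (hdA' i j).symm ▸ div_nonneg (hmA0 i j) (mul_pos hcS0 hcT0).le
  have hdB0 : ∀ j k, 0 ≤ dB j k := fun j k => (hdB' j k).symm ▸ div_nonneg (hmB0 j k) (mul_pos hcT0 hcU0).le
  have hdC0 : ∀ k i, 0 ≤ dC k i := fun k i => (hdC' k i).symm ▸ div_nonneg (hmC0 k i) (mul_pos hcU0 hcS0).le
  -- column sums of `dB` and row sums of `dC` are `1`
  have hcolB : ∀ k, ∑ j : Fin n, dB j k = 1 := by
    intro k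
    have h := sum_pairMarginal_fst T U k
    have h' : ∑ j : Fin n, mB j k = cT * cU := by
      simp only [hmB, hcT, hcU]; exact_mod_cast h
    simp_rw [hdB' _ k]
    rw [← Finset.sum_div, h', div_self (mul_pos hcT0 hcU0).ne']
  have hrowC : ∀ k, ∑ i : Fin n, dC k i = 1 := by
    intro k
    have h := sum_pairMarginal_snd U S k
    have h' : ∑ i : Fin n, mC k i = cU * cS := by
      simp only [hmC, hcU, hcS]; exact_mod_cast h
    simp_rw [hdC' k]
    rw [← Finset.sum_div, h', div_self (mul_pos hcU0 hcS0).ne']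
  clear_value mA mB mC
  /- 2. the heavy parts -/
  have h1n : (0 : ℝ) ≤ 1 / n := by positivity
  have hpB0 : ∀ j k, 0 ≤ pB j k := by
    intro j k; rw [hpB]; split_ifs with h <;> linarith [hinvB, hθB0]
  have hpC0 : ∀ k i, 0 ≤ pC k i := by
    intro k i; rw [hpC]; split_ifs with h <;> linarith [hinvC, hθC0]
  have hpBle : ∀ j k, pB j k ≤ (if θB ≤ dB j k then dB j k else 0) := by
    intro j k; rw [hpB]; split_ifs with h <;> linarith
  have hpCle : ∀ k i, pC k i ≤ (if θC ≤ dC k i then dC k i else 0) := by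
    intro k i; rw [hpC]; split_ifs with h <;> linarith
  have hifB : ∀ j k, (if θB ≤ dB j k then dB j k else 0) ≤ dB j k := fun j k => by
    split_ifs <;> linarith [hdB0 j k]
  have hifC : ∀ k i, (if θC ≤ dC k i then dC k i else 0) ≤ dC k i := fun k i => by
    split_ifs <;> linarith [hdC0 k i]
  have hpBheavy : ∀ j k, θB ≤ dB j k → 15 / 16 * θB ≤ pB j k := fun j k h => by
    rw [hpB, if_pos h]; linarith [hinvB]
  have hpCheavy : ∀ k i, θC ≤ dC k i → 15 / 16 * θC ≤ pC k i := fun k i h => by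
    rw [hpC, if_pos h]; linarith [hinvC]
  /- 3. column / row heavy masses -/
  set σ : Fin n → ℝ := fun k => ∑ j : Fin n, pB j k with hσ
  set ρ : Fin n → ℝ := fun k => ∑ i : Fin n, pC k i with hρ
  have hσk : ∀ k, σ k = ∑ j : Fin n, pB j k := fun k => rfl
  have hρk : ∀ k, ρ k = ∑ i : Fin n, pC k i := fun k => rfl
  clear_value σ ρ
  have hσ0 : ∀ k, 0 ≤ σ k := fun k => by rw [hσk]; exact Finset.sum_nonneg fun j _ => hpB0 j k
  have hρ0 : ∀ k, 0 ≤ ρ k := fun k => by rw [hρk]; exact Finset.sum_nonneg fun i _ => hpC0 k i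
  have hσ1 : ∀ k, σ k ≤ 1 := fun k => by
    rw [hσk, ← hcolB k]; exact Finset.sum_le_sum fun j _ => (hpBle j k).trans (hifB j k)
  have hρ1 : ∀ k, ρ k ≤ 1 := fun k => by
    rw [hρk, ← hrowC k]; exact Finset.sum_le_sum fun i _ => (hpCle k i).trans (hifC k i)
  have hσsum : ∑ k : Fin n, σ k ≤ ∑ j : Fin n, ∑ k : Fin n, (if θB ≤ dB j k then dB j k else 0) := by
    calc ∑ k : Fin n, σ k = ∑ k : Fin n, ∑ j : Fin n, pB j k := Finset.sum_congr rfl fun k _ => hσk k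
      _ = ∑ j : Fin n, ∑ k : Fin n, pB j k := Finset.sum_comm
      _ ≤ ∑ j : Fin n, ∑ k : Fin n, (if θB ≤ dB j k then dB j k else 0) :=
          Finset.sum_le_sum fun j _ => Finset.sum_le_sum fun k _ => hpBle j k
  have hρsum : ∑ k : Fin n, ρ k ≤ ∑ k : Fin n, ∑ i : Fin n, (if θC ≤ dC k i then dC k i else 0) := by
    calc ∑ k : Fin n, ρ k = ∑ k : Fin n, ∑ i : Fin n, pC k i := Finset.sum_congr rfl fun k _ => hρk k
      _ ≤ ∑ k : Fin n, ∑ i : Fin n, (if θC ≤ dC k i then dC k i else 0) :=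
          Finset.sum_le_sum fun k _ => Finset.sum_le_sum fun i _ => hpCle k i
  have hσΛ : ∑ k : Fin n, σ k ≤ Λ := hσsum.trans hmassB
  have hρΛ : ∑ k : Fin n, ρ k ≤ Λ := hρsum.trans hmassC
  have hsharp' : ∑ k : Fin n, σ k ≤ 1 + δ₄ ∨ ∑ k : Fin n, ρ k ≤ 1 + δ₄ :=
    hsharp.imp (fun h => hσsum.trans h) (fun h => hρsum.trans h)
  /- 4. the kept term: `Σ (dA - 1/n) pB pC = Ψ - (1/n) Σ_k σ_k ρ_k` -/
  set Ψ : ℝ := ∑ i : Fin n, ∑ j : Fin n, ∑ k : Fin n, dA i j * pB j k * pC k i with hΨ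
  have hΨ0 : 0 ≤ Ψ := Finset.sum_nonneg fun i _ => Finset.sum_nonneg fun j _ =>
    Finset.sum_nonneg fun k _ => mul_nonneg (mul_nonneg (hdA0 i j) (hpB0 j k)) (hpC0 k i)
  have hprod : ∑ i : Fin n, ∑ j : Fin n, ∑ k : Fin n, pB j k * pC k i = ∑ k : Fin n, σ k * ρ k := by
    rw [Finset.sum_comm]
    rw [Finset.sum_congr rfl fun j _ => Finset.sum_comm]
    rw [Finset.sum_comm]
    refine Finset.sum_congr rfl fun k _ => ?_
    rw [hσk, hρk, Finset.sum_mul_sum]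
  have hkept' : ∑ i : Fin n, ∑ j : Fin n, ∑ k : Fin n, (dA i j - 1 / n) * pB j k * pC k i =
      Ψ - 1 / n * ∑ k : Fin n, σ k * ρ k := by
    rw [← hprod, hΨ, Finset.mul_sum, ← Finset.sum_sub_distrib]
    refine Finset.sum_congr rfl fun i _ => ?_
    rw [Finset.mul_sum, ← Finset.sum_sub_distrib]
    refine Finset.sum_congr rfl fun j _ => ?_
    rw [Finset.mul_sum, ← Finset.sum_sub_distrib]
    refine Finset.sum_congr rfl fun k _ => ?_
    ring
  rw [hkept'] at hkept
  set Sσρ : ℝ := ∑ k : Fin n, σ k * ρ k with hSdef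
  have hSΛ : Sσρ ≤ Λ := by
    calc Sσρ = ∑ k : Fin n, σ k * ρ k := rfl
      _ ≤ ∑ k : Fin n, σ k := Finset.sum_le_sum fun k _ => by nlinarith [hσ0 k, hρ0 k, hρ1 k]
      _ ≤ Λ := hσΛ
  -- `hkept : 1 - δ ≤ -(n-1) * (Ψ - 1/n * Sσρ)`
  have hrew : -((n : ℝ) - 1) * (Ψ - 1 / n * Sσρ) = ((n : ℝ) - 1) / n * Sσρ - ((n : ℝ) - 1) * Ψ := by
    field_simp; ring
  rw [hrew] at hkept
  have hS0' : 0 ≤ Sσρ := Finset.sum_nonneg fun k _ => mul_nonneg (hσ0 k) (hρ0 k)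
  have hfrac : ((n : ℝ) - 1) / n * Sσρ ≤ Sσρ := by
    have : ((n : ℝ) - 1) / n ≤ 1 := by rw [div_le_one hn0]; linarith
    nlinarith
  have hδ1 : δ ≤ 1 := by
    have : 1 / (64 * Λ ^ 2) ≤ 1 := by rw [div_le_one (by positivity)]; nlinarith
    linarith
  have hmass : 1 - δ ≤ Sσρ := by nlinarith
  have hΨΛ : ((n : ℝ) - 1) * Ψ ≤ Λ := by nlinarith
  /- 5. the hub -/
  obtain ⟨k, hk⟩ := exists_hub_of_masses σ ρ Λ δ δ₄ hσ0 hσ1 hρ0 hρ1 hΛ hσΛ hρΛ hδ hδ₄ hsmall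
    hsharp' hmass
  -- heavy sets at the hub
  set J : Finset (Fin n) := Finset.univ.filter fun j => θB ≤ dB j k with hJ
  set I : Finset (Fin n) := Finset.univ.filter fun i => θC ≤ dC k i with hI
  have hmemJ : ∀ j ∈ J, θB ≤ dB j k := fun j hj => (Finset.mem_filter.1 hj).2
  have hmemI : ∀ i ∈ I, θC ≤ dC k i := fun i hi => (Finset.mem_filter.1 hi).2
  have hsumJ : ∑ j ∈ J, dB j k = ∑ j : Fin n, (if θB ≤ dB j k then dB j k else 0) := by
    rw [hJ, Finset.sum_filter]
  have hsumI : ∑ i ∈ I, dC k i = ∑ i : Fin n, (if θC ≤ dC k i then dC k i else 0) := by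
    rw [hI, Finset.sum_filter]
  clear_value J I
  have hJcard : (J.card : ℝ) * θB ≤ 1 := by
    calc (J.card : ℝ) * θB = ∑ _j ∈ J, θB := by rw [Finset.sum_const, nsmul_eq_mul]
      _ ≤ ∑ j ∈ J, dB j k := Finset.sum_le_sum fun j hj => hmemJ j hj
      _ ≤ ∑ j : Fin n, dB j k :=
          Finset.sum_le_sum_of_subset_of_nonneg (Finset.subset_univ J) fun j _ _ => hdB0 j k
      _ = 1 := hcolB k
  have hIcard : (I.card : ℝ) * θC ≤ 1 := by
    calc (I.card : ℝ) * θC = ∑ _i ∈ I, θC := by rw [Finset.sum_const, nsmul_eq_mul]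
      _ ≤ ∑ i ∈ I, dC k i := Finset.sum_le_sum fun i hi => hmemI i hi
      _ ≤ ∑ i : Fin n, dC k i :=
          Finset.sum_le_sum_of_subset_of_nonneg (Finset.subset_univ I) fun i _ _ => hdC0 k i
      _ = 1 := hrowC k
  /- 6. the three laws at the hub -/
  set μ : Fin n → ℝ := fun v => ((U.filter fun u => u k = v).card : ℝ) / cU with hμ
  set X : Fin n → ℝ := fun v => ((T.filter fun t => t⁻¹ v ∈ J).card : ℝ) / cT with hX
  set Y : Fin n → ℝ := fun v => ((S.filter fun s => s⁻¹ v ∈ I).card : ℝ) / cS with hY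
  have hμ0 : ∀ v, 0 ≤ μ v := fun v => by rw [hμ]; exact div_nonneg (Nat.cast_nonneg _) hcU0.le
  have hX0 : ∀ v, 0 ≤ X v := fun v => by rw [hX]; exact div_nonneg (Nat.cast_nonneg _) hcT0.le
  have hY0 : ∀ v, 0 ≤ Y v := fun v => by rw [hY]; exact div_nonneg (Nat.cast_nonneg _) hcS0.le
  have hX1 : ∀ v, X v ≤ 1 := fun v => by
    rw [hX]; dsimp only; rw [div_le_one hcT0]
    exact hTfil _
  have hY1 : ∀ v, Y v ≤ 1 := fun v => by
    rw [hY]; dsimp only; rw [div_le_one hcS0]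
    exact hSfil _
  have hμ1 : ∑ v : Fin n, μ v = 1 := by
    rw [hμ]; dsimp only
    rw [← Finset.sum_div, hUcol k, div_self hcUne]
  clear_value μ X Y
  -- scalar identities (kept free of the big definitions)
  have key2U : ∀ a b : ℝ, a / cU * (b / cT) = a * b / (cT * cU) := by
    intro a b; rw [div_mul_div_comm, mul_comm cU cT]
  have key2S : ∀ a b : ℝ, a / cU * (b / cS) = a * b / (cU * cS) := by
    intro a b; rw [div_mul_div_comm]
  have key2T : ∀ a b : ℝ, a / cT * (b / cS) = a * b / (cS * cT) := by
    intro a b; rw [div_mul_div_comm, mul_comm cT cS]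
  -- `Σ_v μ X = Σ_{j ∈ J} dB j k ≥ σ k`
  have hμX : σ k ≤ ∑ v : Fin n, μ v * X v := by
    have hcol := sum_pairMarginal_col_block_eq T U J k
    have hcolR : ∑ j ∈ J, mB j k = ∑ v : Fin n,
        ((U.filter fun u => u k = v).card : ℝ) * ((T.filter fun t => t⁻¹ v ∈ J).card : ℝ) := by
      simp only [hmB]; exact_mod_cast hcol
    have e1 : ∑ v : Fin n, μ v * X v = (∑ j ∈ J, mB j k) / (cT * cU) := by
      rw [hcolR, Finset.sum_div]
      refine Finset.sum_congr rfl fun v _ => ?_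
      rw [hμ, hX]; dsimp only
      rw [key2U]
    have e2 : (∑ j ∈ J, mB j k) / (cT * cU) = ∑ j ∈ J, dB j k := by
      rw [Finset.sum_div]
      exact Finset.sum_congr rfl fun j _ => (hdB' j k).symm
    rw [e1, e2]
    calc σ k = ∑ j : Fin n, pB j k := hσk k
      _ ≤ ∑ j : Fin n, (if θB ≤ dB j k then dB j k else 0) := Finset.sum_le_sum fun j _ => hpBle j k
      _ = ∑ j ∈ J, dB j k := hsumJ.symm
  -- `Σ_v μ Y = Σ_{i ∈ I} dC k i ≥ ρ k`
  have hμY : ρ k ≤ ∑ v : Fin n, μ v * Y v := by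
    have hrow := sum_pairMarginal_row_block_eq U S I k
    have hrowR : ∑ i ∈ I, mC k i = ∑ v : Fin n,
        ((U.filter fun u => u k = v).card : ℝ) * ((S.filter fun s => s⁻¹ v ∈ I).card : ℝ) := by
      simp only [hmC]; exact_mod_cast hrow
    have e1 : ∑ v : Fin n, μ v * Y v = (∑ i ∈ I, mC k i) / (cU * cS) := by
      rw [hrowR, Finset.sum_div]
      refine Finset.sum_congr rfl fun v _ => ?_
      rw [hμ, hY]; dsimp only
      rw [key2S]
    have e2 : (∑ i ∈ I, mC k i) / (cU * cS) = ∑ i ∈ I, dC k i := by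
      rw [Finset.sum_div]
      exact Finset.sum_congr rfl fun i _ => (hdC' k i).symm
    rw [e1, e2]
    calc ρ k = ∑ i : Fin n, pC k i := hρk k
      _ ≤ ∑ i : Fin n, (if θC ≤ dC k i then dC k i else 0) := Finset.sum_le_sum fun i _ => hpCle k i
      _ = ∑ i ∈ I, dC k i := hsumI.symm
  -- FORCED HITS: `Σ_v X Y = Σ_{i ∈ I, j ∈ J} dA i j ≤ Ψ/((15/16)² θB θC)`
  set Z : ℝ := 256 / 225 * Λ / (((n : ℝ) - 1) * θB * θC) with hZ
  have hZ0 : 0 < Z := by rw [hZ]; positivity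
  have hforced : ∑ v : Fin n, X v * Y v ≤ Z := by
    -- the identity
    have hblock := sum_pairMarginal_block_eq S T I J
    have hblockR : ∑ i ∈ I, ∑ j ∈ J, mA i j = ∑ v : Fin n,
        ((T.filter fun t => t⁻¹ v ∈ J).card : ℝ) * ((S.filter fun s => s⁻¹ v ∈ I).card : ℝ) := by
      simp only [hmA]; exact_mod_cast hblock
    have e1 : ∑ v : Fin n, X v * Y v = ∑ i ∈ I, ∑ j ∈ J, dA i j := by
      have : ∑ v : Fin n, X v * Y v = (∑ i ∈ I, ∑ j ∈ J, mA i j) / (cS * cT) := by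
        rw [hblockR, Finset.sum_div]
        refine Finset.sum_congr rfl fun v _ => ?_
        rw [hX, hY]; dsimp only
        rw [key2T]
      rw [this, Finset.sum_div]
      refine Finset.sum_congr rfl fun i _ => ?_
      rw [Finset.sum_div]
      exact Finset.sum_congr rfl fun j _ => (hdA' i j).symm
    -- the single-`k` part of `Ψ` restricted to `I × J`
    have e2 : (15 / 16 * θB) * (15 / 16 * θC) * ∑ i ∈ I, ∑ j ∈ J, dA i j ≤ Ψ := by
      calc (15 / 16 * θB) * (15 / 16 * θC) * ∑ i ∈ I, ∑ j ∈ J, dA i j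
          = ∑ i ∈ I, ∑ j ∈ J, dA i j * (15 / 16 * θB) * (15 / 16 * θC) := by
            rw [Finset.mul_sum]
            refine Finset.sum_congr rfl fun i _ => ?_
            rw [Finset.mul_sum]
            refine Finset.sum_congr rfl fun j _ => ?_
            ring
        _ ≤ ∑ i ∈ I, ∑ j ∈ J, dA i j * pB j k * pC k i := by
            refine Finset.sum_le_sum fun i hi => Finset.sum_le_sum fun j hj => ?_
            have hi' := hpCheavy k i (hmemI i hi)
            have hj' := hpBheavy j k (hmemJ j hj)
            have h15B : 0 ≤ 15 / 16 * θB := by positivity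
            have h15C : 0 ≤ 15 / 16 * θC := by positivity
            have := mul_le_mul (mul_le_mul_of_nonneg_left hj' (hdA0 i j)) hi' h15C
              (mul_nonneg (hdA0 i j) (hpB0 j k))
            linarith
        _ ≤ ∑ i : Fin n, ∑ j ∈ J, dA i j * pB j k * pC k i :=
            Finset.sum_le_sum_of_subset_of_nonneg (Finset.subset_univ I) fun i _ _ =>
              Finset.sum_nonneg fun j _ => mul_nonneg (mul_nonneg (hdA0 i j) (hpB0 j k)) (hpC0 k i)
        _ ≤ ∑ i : Fin n, ∑ j : Fin n, dA i j * pB j k * pC k i :=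
            Finset.sum_le_sum fun i _ => Finset.sum_le_sum_of_subset_of_nonneg
              (Finset.subset_univ J) fun j _ _ =>
                mul_nonneg (mul_nonneg (hdA0 i j) (hpB0 j k)) (hpC0 k i)
        _ ≤ ∑ i : Fin n, ∑ j : Fin n, ∑ k' : Fin n, dA i j * pB j k' * pC k' i :=
            Finset.sum_le_sum fun i _ => Finset.sum_le_sum fun j _ =>
              Finset.single_le_sum (f := fun k' => dA i j * pB j k' * pC k' i)
                (fun k' _ => mul_nonneg (mul_nonneg (hdA0 i j) (hpB0 j k')) (hpC0 k' i))
                (Finset.mem_univ k)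
        _ = Ψ := rfl
    rw [e1]
    -- divide
    have hθθ : 0 < (15 / 16 * θB) * (15 / 16 * θC) := by positivity
    have e3 : ∑ i ∈ I, ∑ j ∈ J, dA i j ≤ Ψ / ((15 / 16 * θB) * (15 / 16 * θC)) := by
      rw [le_div_iff₀ hθθ]; linarith
    have e4 : Ψ ≤ Λ / ((n : ℝ) - 1) := by rw [le_div_iff₀ hm0]; linarith
    calc ∑ i ∈ I, ∑ j ∈ J, dA i j ≤ Ψ / ((15 / 16 * θB) * (15 / 16 * θC)) := e3
      _ ≤ (Λ / ((n : ℝ) - 1)) / ((15 / 16 * θB) * (15 / 16 * θC)) :=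
          div_le_div_of_nonneg_right e4 hθθ.le
      _ = Z := by rw [hZ]; field_simp; ring
  /- 7. a good common value -/
  obtain ⟨v, hv⟩ := exists_good_value μ X Y Λ Z (σ k) (ρ k) hμ0 hμ1 hX0 hX1 hY0 hY1 hΛ hZ0 hμX hμY
    hk hforced
  /- 8. fibring at `(k, v)` -/
  have hfib := hub_fibring B hB hTPP I J k v
  have hfibR : ((S.filter fun s => s⁻¹ v ∈ I).card : ℝ) * ((T.filter fun t => t⁻¹ v ∈ J).card : ℝ) *
      ((U.filter fun u => u k = v).card : ℝ) ≤ (I.card : ℝ) * (J.card : ℝ) * B := by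
    exact_mod_cast hfib
  -- the sub-triple has volume `N · μ X Y`
  have key3 : ∀ a b c : ℝ, cS * cT * cU * (a / cU * (b / cT) * (c / cS)) = c * b * a := by
    intro a b c; field_simp
  have hvol : cS * cT * cU * (μ v * X v * Y v) =
      ((S.filter fun s => s⁻¹ v ∈ I).card : ℝ) * ((T.filter fun t => t⁻¹ v ∈ J).card : ℝ) *
        ((U.filter fun u => u k = v).card : ℝ) := by
    rw [hμ, hX, hY]; dsimp only
    rw [key3]
  -- `|I||J| ≤ 1/(θB θC)`
  have hIJ : (I.card : ℝ) * (J.card : ℝ) * B ≤ B / (θB * θC) := by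
    rw [le_div_iff₀ (by positivity)]
    have hB0 : (0 : ℝ) ≤ B := Nat.cast_nonneg _
    have h1 : (I.card : ℝ) * θC * ((J.card : ℝ) * θB) ≤ 1 * 1 :=
      mul_le_mul hIcard hJcard (mul_nonneg (Nat.cast_nonneg _) hθB0.le) zero_le_one
    nlinarith
  -- assemble: `N/(64 Λ² Z) ≤ N μXY ≤ B/(θB θC)`
  have hN0 : 0 < cS * cT * cU := mul_pos (mul_pos hcS0 hcT0) hcU0
  have h1 : cS * cT * cU * (1 / (64 * Λ ^ 2 * Z)) ≤ B / (θB * θC) := by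
    calc cS * cT * cU * (1 / (64 * Λ ^ 2 * Z)) ≤ cS * cT * cU * (μ v * X v * Y v) :=
          mul_le_mul_of_nonneg_left hv hN0.le
      _ = _ := hvol
      _ ≤ (I.card : ℝ) * (J.card : ℝ) * B := hfibR
      _ ≤ B / (θB * θC) := hIJ
  rw [hNe]
  have h64 : 0 < 64 * Λ ^ 2 * Z := by positivity
  have h2 : cS * cT * cU ≤ 64 * Λ ^ 2 * Z * (B / (θB * θC)) := by
    have := mul_le_mul_of_nonneg_left h1 h64.le
    have e : 64 * Λ ^ 2 * Z * (cS * cT * cU * (1 / (64 * Λ ^ 2 * Z))) = cS * cT * cU := by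
      field_simp
    linarith [e]
  have h3 : 64 * Λ ^ 2 * Z * (B / (θB * θC)) = (64 * 256 / 225) * Λ ^ 3 * B /
      (((n : ℝ) - 1) * θB ^ 2 * θC ^ 2) := by
    rw [hZ]; field_simp
  rw [h3] at h2
  have hB0 : (0 : ℝ) ≤ B := Nat.cast_nonneg _
  have h4 : (64 * 256 / 225) * Λ ^ 3 * B / (((n : ℝ) - 1) * θB ^ 2 * θC ^ 2) ≤
      100 * Λ ^ 3 * B / (((n : ℝ) - 1) * θB ^ 2 * θC ^ 2) := by
    apply div_le_div_of_nonneg_right _ (by positivity)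
    have : 0 ≤ Λ ^ 3 * B := by positivity
    nlinarith
  exact h2.trans h4

end Summit.MatrixMultiplication.MatrixMultiplication.Theorems.PolynomialSlack
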